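import Literature.Barriers.ABC.EpsilonCannotBeDropped
import Literature.NumberTheory.DiophantineGeometry.BrightLowerBoundAsymptotics
import Literature.Analysis.SpecialFunctions.BrightRankinConstant
import HarnessLib

/-!
# Conjecture A of Robert–Stewart–Tenenbaum implies the abc conjecture (proofs)

Sibling proof file of `EpsilonCannotBeDropped.lean` (D-0014); no new definitions.

Robert–Stewart–Tenenbaum, *A refinement of the abc conjecture*, Bull. LMS 46 (2014) 1156–1166,
§1, p. 1157, state **Conjecture A** — (1·5) `c < k exp(4 √(3 log k / log₂ k)
(1 + log₃ k / (2 log₂ k) + C₁ / log₂ k))` for all coprime positive `a + b = c`, `k = k(abc)`,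
vendored as the named fact `RSTConjectureAUpper` — and remark right after it: "it follows from
Conjecture A that for each `ε > 0`, we can select `A₂ = 4√3 + ε` in (1·3) for large `k`",
where (1·3) is van Frankenhuijsen's `c < k exp(A₂ √(log k / log₂ k))`; a fortiori Conjecture A
implies the abc conjecture (1·1) `c < A₀(ε) k^{1+ε}`. We PROVE the latter implication,
`RSTConjectureAUpper.imp_abc`, with the conclusion spelled exactly as the `ABC` summit sentence
(`Summits/ABC/ABC/Statement.lean`, `ABC_iff`; `Literature/` may not import `Problems/`).

Consequence for the catalogue: `RSTConjectureAUpper` is an OPEN conjecture in print (the paper's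
own label, resting on "the heuristic assumption that whenever `a` and `b` are coprime positive
integers `k(a + b)` is statistically independent of `k(a)` and `k(b)`"), and by the theorem below
it is at least as strong as the abc conjecture; it is therefore not a dischargeable fact.

The argument is elementary: `log₂ k, log₃ k ≥ 1` and `log₃ k ≤ log₂ k` (as `log y ≤ y`) give
`rstExponent C k ≤ 4√3 (3/2 + |C|) √(log k)` for real `k ≥ 1` (`rstExponent_le`), and
`A √x ≤ ε x + A²/(4ε)` (`mul_le_eps_mul_sq_add`), whence
`c < k e^{rstExponent C₁ k} ≤ e^{A²/(4ε)} k^{1+ε}` with `A = 4√3 (3/2 + |C₁|)`.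

Lower half (second block below): `RSTConjectureALower`, (1·6) of Conjecture A, is likewise an
OPEN conjecture in print and is not discharged; we prove the paper's remark that it yields (1·4)
with `A₃ = 4√3 − ε` for every `ε > 0` (`RSTConjectureALower.vanFrankenhuijsenForm`), that any
bound of the form (1·4) with `A₃ > 0` implies the Stewart–Tijdeman form `EpsilonCannotBeDropped`
(`epsilonCannotBeDropped_of_lowerForm`), hence `RSTConjectureALower → EpsilonCannotBeDropped`
(`RSTConjectureALower.epsilonCannotBeDropped`): the conjectured frontier lies beyond the proved
barrier (1·7).

Audit additions (2026-08-15, barrier audit D-0021; last block of the file): the general clause of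
the barrier's `blocks:` line is derived from the named fact
(`EpsilonCannotBeDropped.not_subST_strengthening`), and the "uniform constant" variant of abc is
refuted (`not_abc_uniform_constant`); the polylogarithmic clause is proved unconditionally in the
second sibling `EpsilonCannotBeDroppedPolylog.lean`.

Discharge of `bright2024_lowerBound` (2026-08-15; block `bright2024_lowerBound_holds` at the end of
the file): Bright's Theorem 3.1 with the constant `6.563` is PROVED — Rankin's `ℓ₁` bound
(`Literature.Algebra.EuclideanLattices.Rankin.exists_ne_zero_l1_le`, its finite-index form
`…exists_mem_ne_zero_l1_le_of_finiteIndex`), the kernel sublattice of the odd-prime lattice and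
Lemma 3.1 (`Literature.NumberTheory.DiophantineGeometry.exists_abcTriple_two_mul_log_le_rankinBound`),
the prime number theorem along the primes (`Literature.NumberTheory.LFunctions.tendsto_sum_log_nth_prime_div_sub_log`,
`…tendsto_card_mul_log_nth_prime_div`), the asymptotic optimisation of §3.1 at the Rankin parameter
`x` (`Literature.NumberTheory.DiophantineGeometry.bright_infinite_abcTriples`: `κ² e/32 < δ(x)`,
`δ(x) = ((1-x)/(2-x))^{x-1}(e/x)^x Γ(1+x)`, gives infinitely many triples with
`rad(abc) e^{κ√(log c)/log log c} < c`) and the certified inequality `6.563² e/32 < δ(9/14)`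
(`Literature.Analysis.SpecialFunctions.bright_rankin_constant_lt`; the paper's optimal `x ≈ 0.6455`
gives `δ ≈ 3.65931`, constant `≈ 6.56338`; at `x = 9/14`, `4√(2δ/e) = 6.56336… > 6.563`).

## References

* O. Robert, C. L. Stewart, G. Tenenbaum, *A refinement of the abc conjecture*, Bull. London
  Math. Soc. 46 (2014) 1156–1166, §1: (1·1), (1·3), Conjecture A (1·5) and the remark following
  it. [cite: RobertStewartTenenbaum2014, §1]
* ibid., §1: (1·4), Conjecture A (1·6), (1·7), the same remark (`A₃ = 4√3 − ε`); §4, first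
  paragraph (the heuristic assumption). [cite: RobertStewartTenenbaum2014, §1 and §4]
* C. Bright, *A new lower bound in the abc conjecture*, Canad. Math. Bull. 67 (2024) 369–378,
  Abstract, Corollary 2.4, Lemma 3.1 and Theorem 3.1. [cite: Bright2024, Theorem 3.1]
-/

noncomputable section

open Literature.NumberTheory.DiophantineGeometry UniqueFactorizationMonoid

namespace Literature.Barriers.ABC

/-- Successor rule for the iterated logarithm: `logIter (j+1) x = max 1 (log (logIter j x))`.
[folklore] -/
theorem logIter_succ (j : ℕ) (x : ℝ) : logIter (j + 1) x = max 1 (Real.log (logIter j x)) := by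
  show (fun x ↦ max 1 (Real.log x))^[j + 1] x =
    max 1 (Real.log ((fun x ↦ max 1 (Real.log x))^[j] x))
  rw [Function.iterate_succ_apply']

/-- `logIter (j+1) x ≥ 1` for every `j` and `x`. [folklore] -/
theorem one_le_logIter_succ (j : ℕ) (x : ℝ) : 1 ≤ logIter (j + 1) x := by
  rw [logIter_succ]
  exact le_max_left _ _

/-- The iterated logarithms decrease: `logIter (j+2) x ≤ logIter (j+1) x` (from `log y ≤ y`).
[folklore] -/
theorem logIter_succ_succ_le (j : ℕ) (x : ℝ) : logIter (j + 2) x ≤ logIter (j + 1) x := by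
  rw [logIter_succ (j + 1)]
  exact max_le (one_le_logIter_succ j x)
    (Real.log_le_self (le_trans zero_le_one (one_le_logIter_succ j x)))

/-- Crude size of the Robert–Stewart–Tenenbaum exponent: for real `k ≥ 1`,
`rstExponent C k ≤ 4 √3 · (3/2 + |C|) · √(log k)`. [folklore] -/
theorem rstExponent_le (C : ℝ) {k : ℝ} (hk : 1 ≤ k) :
    rstExponent C k ≤ 4 * Real.sqrt 3 * (3 / 2 + |C|) * Real.sqrt (Real.log k) := by
  have hlog : 0 ≤ Real.log k := Real.log_nonneg hk
  have hL2 : 1 ≤ logIter 2 k := one_le_logIter_succ 1 k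
  have hL2pos : 0 < logIter 2 k := lt_of_lt_of_le one_pos hL2
  have hL32 : logIter 3 k ≤ logIter 2 k := logIter_succ_succ_le 1 k
  have hsqrt : Real.sqrt (3 * Real.log k / logIter 2 k) ≤ Real.sqrt 3 * Real.sqrt (Real.log k) := by
    rw [← Real.sqrt_mul (by norm_num : (0 : ℝ) ≤ 3)]
    apply Real.sqrt_le_sqrt
    rw [div_le_iff₀ hL2pos]
    calc 3 * Real.log k = 3 * Real.log k * 1 := (mul_one _).symm
      _ ≤ 3 * Real.log k * logIter 2 k := mul_le_mul_of_nonneg_left hL2 (by positivity)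
  have hbr : 1 + logIter 3 k / (2 * logIter 2 k) + C / logIter 2 k ≤ 3 / 2 + |C| := by
    have h1 : logIter 3 k / (2 * logIter 2 k) ≤ 1 / 2 := by
      rw [div_le_div_iff₀ (by positivity) (by norm_num : (0 : ℝ) < 2)]
      linarith
    have h2 : C / logIter 2 k ≤ |C| :=
      calc C / logIter 2 k ≤ |C| / logIter 2 k :=
            div_le_div_of_nonneg_right (le_abs_self C) hL2pos.le
        _ ≤ |C| / 1 := div_le_div_of_nonneg_left (abs_nonneg C) one_pos hL2
        _ = |C| := div_one _
    linarith
  unfold rstExponent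
  calc 4 * Real.sqrt (3 * Real.log k / logIter 2 k) *
        (1 + logIter 3 k / (2 * logIter 2 k) + C / logIter 2 k)
      ≤ 4 * Real.sqrt (3 * Real.log k / logIter 2 k) * (3 / 2 + |C|) :=
        mul_le_mul_of_nonneg_left hbr (by positivity)
    _ ≤ 4 * (Real.sqrt 3 * Real.sqrt (Real.log k)) * (3 / 2 + |C|) := by
        apply mul_le_mul_of_nonneg_right _ (by positivity)
        exact mul_le_mul_of_nonneg_left hsqrt (by norm_num)
    _ = 4 * Real.sqrt 3 * (3 / 2 + |C|) * Real.sqrt (Real.log k) := by ring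

/-- AM–GM step: `A s ≤ ε s² + A²/(4ε)` for `ε > 0`. [folklore] -/
theorem mul_le_eps_mul_sq_add (A s : ℝ) {ε : ℝ} (hε : 0 < ε) :
    A * s ≤ ε * s ^ 2 + A ^ 2 / (4 * ε) := by
  have hε0 : ε ≠ 0 := hε.ne'
  have h : ε * s ^ 2 + A ^ 2 / (4 * ε) - A * s = ε * (s - A / (2 * ε)) ^ 2 := by
    field_simp
    ring
  have h' : 0 ≤ ε * (s - A / (2 * ε)) ^ 2 := mul_nonneg hε.le (sq_nonneg _)
  linarith

/-- **Conjecture A (upper half) implies the abc conjecture** (Robert–Stewart–Tenenbaum, Bull. LMS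
46 (2014), §1, remark following Conjecture A: "it follows from Conjecture A that for each `ε > 0`,
we can select `A₂ = 4√3 + ε` in (1·3) for large `k`"; (1·3) trivially implies (1·1)). Precisely:
`RSTConjectureAUpper` implies, for every real `ε > 0`, the existence of a real `C > 0` with
`c < C · rad(abc)^{1+ε}` for every abc triple — the sentence of the `ABC` summit verbatim. In
particular the named fact `RSTConjectureAUpper` is an open problem at least as strong as abc.
Proof: `c < k e^{rstExponent C₁ k} ≤ k e^{A√(log k)} ≤ e^{A²/(4ε)} k^{1+ε}` with
`A = 4√3 (3/2 + |C₁|)`. [cite: RobertStewartTenenbaum2014, §1, remark following Conjecture A] -/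
theorem RSTConjectureAUpper.imp_abc (h : RSTConjectureAUpper) :
    ∀ ε : ℝ, 0 < ε → ∃ C : ℝ, 0 < C ∧
      ∀ a b c : ℕ, IsABCTriple a b c → (c : ℝ) < C * ((rad a b c : ℕ) : ℝ) ^ (1 + ε) := by
  obtain ⟨C₁, hC₁⟩ := h
  intro ε hε
  refine ⟨Real.exp ((4 * Real.sqrt 3 * (3 / 2 + |C₁|)) ^ 2 / (4 * ε)), Real.exp_pos _, ?_⟩
  intro a b c habc
  have hlt := hC₁ a b c habc
  have hk1' : 1 ≤ rad a b c := by
    rw [rad_def]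
    exact Nat.succ_le_of_lt (Nat.radical_pos _)
  have hk1 : (1 : ℝ) ≤ ((rad a b c : ℕ) : ℝ) := by exact_mod_cast hk1'
  have hkpos : (0 : ℝ) < ((rad a b c : ℕ) : ℝ) := lt_of_lt_of_le one_pos hk1
  have hlog : 0 ≤ Real.log ((rad a b c : ℕ) : ℝ) := Real.log_nonneg hk1
  have h1 : rstExponent C₁ ((rad a b c : ℕ) : ℝ) ≤
      4 * Real.sqrt 3 * (3 / 2 + |C₁|) * Real.sqrt (Real.log ((rad a b c : ℕ) : ℝ)) :=
    rstExponent_le C₁ hk1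
  have h2 : 4 * Real.sqrt 3 * (3 / 2 + |C₁|) * Real.sqrt (Real.log ((rad a b c : ℕ) : ℝ)) ≤
      ε * Real.log ((rad a b c : ℕ) : ℝ) + (4 * Real.sqrt 3 * (3 / 2 + |C₁|)) ^ 2 / (4 * ε) := by
    have := mul_le_eps_mul_sq_add (4 * Real.sqrt 3 * (3 / 2 + |C₁|))
      (Real.sqrt (Real.log ((rad a b c : ℕ) : ℝ))) hε
    rwa [Real.sq_sqrt hlog] at this
  calc (c : ℝ) < ((rad a b c : ℕ) : ℝ) * Real.exp (rstExponent C₁ ((rad a b c : ℕ) : ℝ)) := hlt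
    _ ≤ ((rad a b c : ℕ) : ℝ) *
          Real.exp (ε * Real.log ((rad a b c : ℕ) : ℝ) +
            (4 * Real.sqrt 3 * (3 / 2 + |C₁|)) ^ 2 / (4 * ε)) := by
        gcongr
        exact h1.trans h2
    _ = Real.exp ((4 * Real.sqrt 3 * (3 / 2 + |C₁|)) ^ 2 / (4 * ε)) *
          ((rad a b c : ℕ) : ℝ) ^ (1 + ε) := by
        rw [Real.rpow_add hkpos, Real.rpow_one, Real.rpow_def_of_pos hkpos, Real.exp_add,
          mul_comm (Real.log _) ε]
        ring


/-! ### Conjecture A, lower half: where (1·6) sits relative to the proved barrier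

`RSTConjectureALower` is (1·6) of Robert–Stewart–Tenenbaum's Conjecture A — like (1·5) a
conjecture, obtained in §4 of the paper only "under the heuristic assumption that, whenever `a` and
`b` are coprime integers, the kernel `k(a + b)` is distributed as if `a + b` was a typical integer
of the same size" [cite: RobertStewartTenenbaum2014, §4]; it is not a theorem there and is not
asserted here (so there is no `RSTConjectureALower_holds`). What *is* elementary, and is proved
below, is the paper's remark locating it: "it follows from Conjecture A that for each `ε > 0`, we
can select … `A₃ = 4√3 − ε` in (1·4)" [cite: RobertStewartTenenbaum2014, §1, Remark after
Conjecture A], where (1·4) is van Frankenhuijsen's proposed form `c > k exp(A₃ √(log k / log₂ k))`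
for infinitely many pairs (`RSTConjectureALower.vanFrankenhuijsenForm`); and any such bound with
`A₃ > 0` implies the Stewart–Tijdeman form `EpsilonCannotBeDropped` for every `δ > 0`
(`epsilonCannotBeDropped_of_lowerForm`), because `√(log k / log₂ k)` exceeds `√(log k) / log₂ k`
by the factor `√(log₂ k) → ∞`. So the conjectured frontier (1·6) lies beyond every proved lower
bound — (1·7) `(4 − ε) √(log k) / log₂ k` (Stewart–Tijdeman 1986), `6.068` (van Frankenhuijsen
2000) [cite: RobertStewartTenenbaum2014, §1 (1·7)], `6.563` (Bright 2024)
[cite: Bright2024, Theorem 3.1] — and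
`RSTConjectureALower.epsilonCannotBeDropped` records `RSTConjectureALower → EpsilonCannotBeDropped`.
No growth of `k` along the family is needed for these transfers (hence no `S`-unit theorem): the
triples with bounded radical that violate the weaker bound have bounded `c`, so they are finitely
many (`infinite_lowerFamily_mono`). -/

/-- abc triples with `c ≤ X` form a finite set (they lie in `[0, X]³`). [folklore] -/
theorem finite_isABCTriple_le (X : ℕ) :
    {t : ℕ × ℕ × ℕ | IsABCTriple t.1 t.2.1 t.2.2 ∧ t.2.2 ≤ X}.Finite := by
  refine ((Set.finite_Iic X).prod ((Set.finite_Iic X).prod (Set.finite_Iic X))).subset ?_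
  rintro ⟨a, b, c⟩ ⟨⟨ha, hb, habc, -⟩, hcX⟩
  simp only [Set.mem_prod, Set.mem_Iic] at *
  omega

/-- **Transfer lemma for lower-bound families.** If infinitely many abc triples satisfy
`G₁(k) < c` (`k = rad(abc)`) and `G₂ k ≤ G₁ k` for all `k ≥ K`, then infinitely many abc triples
satisfy `G₂(k) < c`. (The triples of the first family with `k < K` and `c ≤ G₂(k)` have
`c ≤ ⌈∑_{k<K} |G₂ k|⌉`, so they are finitely many.) [folklore] -/
theorem infinite_lowerFamily_mono {G₁ G₂ : ℕ → ℝ} (K : ℕ) (hG : ∀ k, K ≤ k → G₂ k ≤ G₁ k)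
    (h : {t : ℕ × ℕ × ℕ | IsABCTriple t.1 t.2.1 t.2.2 ∧ G₁ (rad t.1 t.2.1 t.2.2) < t.2.2}.Infinite) :
    {t : ℕ × ℕ × ℕ | IsABCTriple t.1 t.2.1 t.2.2 ∧ G₂ (rad t.1 t.2.1 t.2.2) < t.2.2}.Infinite := by
  set M : ℕ := ⌈∑ k ∈ Finset.range K, |G₂ k|⌉₊
  refine (h.sdiff (finite_isABCTriple_le M)).mono ?_
  rintro ⟨a, b, c⟩ ⟨⟨habc, hlt⟩, hnot⟩
  refine ⟨habc, ?_⟩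
  have hcM : M < c := by
    by_contra hle
    exact hnot ⟨habc, not_lt.mp hle⟩
  by_cases hk : K ≤ rad a b c
  · exact lt_of_le_of_lt (hG _ hk) hlt
  · rw [not_le] at hk
    have h1 : G₂ (rad a b c) ≤ ∑ k ∈ Finset.range K, |G₂ k| :=
      le_trans (le_abs_self _)
        (Finset.single_le_sum (f := fun k => |G₂ k|) (fun i _ => abs_nonneg _)
          (Finset.mem_range.mpr hk))
    have h2 : (∑ k ∈ Finset.range K, |G₂ k|) ≤ (M : ℝ) := Nat.le_ceil _
    have h3 : ((M : ℕ) : ℝ) < ((c : ℕ) : ℝ) := by exact_mod_cast hcM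
    simp only at h3 ⊢
    linarith

/-- Threshold lemma: `log₂ k ≥ B` as soon as `k ≥ exp (exp B)`. [folklore] -/
theorem le_logIter_two_of_le {B k : ℝ} (hk : Real.exp (Real.exp B) ≤ k) : B ≤ logIter 2 k := by
  rw [logIter_two]
  have hkpos : 0 < k := lt_of_lt_of_le (Real.exp_pos _) hk
  have h1 : Real.exp B ≤ Real.log k := (Real.le_log_iff_exp_le hkpos).mpr hk
  have hlogpos : 0 < Real.log k := lt_of_lt_of_le (Real.exp_pos _) h1
  have h2 : B ≤ Real.log (Real.log k) := (Real.le_log_iff_exp_le hlogpos).mpr h1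
  calc B ≤ Real.log (Real.log k) := h2
    _ ≤ Real.log (max 1 (Real.log k)) := Real.log_le_log hlogpos (le_max_right _ _)
    _ ≤ max 1 (Real.log (max 1 (Real.log k))) := le_max_right _ _

/-- The pointwise comparison behind the paper's remark: once `log₂ k ≥ 4√3 |C| / ε`,
`(4√3 − ε) √(log k / log₂ k) ≤ rstExponent C k =
4 √(3 log k / log₂ k) (1 + log₃ k / (2 log₂ k) + C / log₂ k)`, using `log₃ k / (2 log₂ k) ≥ 0`
(for `log k < 0` both sides vanish, `Real.sqrt` of a negative number being `0`).
[cite: RobertStewartTenenbaum2014, §1, Remark after Conjecture A] -/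
theorem rstExponent_ge {C ε k : ℝ} (hε : 0 < ε) (hL : 4 * Real.sqrt 3 * |C| / ε ≤ logIter 2 k) :
    (4 * Real.sqrt 3 - ε) * Real.sqrt (Real.log k / logIter 2 k) ≤ rstExponent C k := by
  unfold rstExponent
  have hL₂ : 1 ≤ logIter 2 k := one_le_logIter_succ 1 k
  have hL₃ : 1 ≤ logIter 3 k := one_le_logIter_succ 2 k
  have hL₂pos : 0 < logIter 2 k := by linarith
  have hsqrt3X : Real.sqrt (3 * Real.log k / logIter 2 k) =
      Real.sqrt 3 * Real.sqrt (Real.log k / logIter 2 k) := by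
    rw [mul_div_assoc, Real.sqrt_mul (by norm_num : (0:ℝ) ≤ 3)]
  rw [hsqrt3X]
  set s := Real.sqrt (Real.log k / logIter 2 k)
  have hs : 0 ≤ s := Real.sqrt_nonneg _
  have hfrac : 0 ≤ logIter 3 k / (2 * logIter 2 k) := div_nonneg (by linarith) (by linarith)
  have hkey : -ε * logIter 2 k ≤ 4 * Real.sqrt 3 * C := by
    have h1 : 4 * Real.sqrt 3 * |C| ≤ logIter 2 k * ε := (div_le_iff₀ hε).mp hL
    have h2 : -|C| ≤ C := neg_abs_le C
    have h3 : 0 ≤ Real.sqrt 3 := Real.sqrt_nonneg _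
    nlinarith
  have h4 : -ε ≤ 4 * Real.sqrt 3 * C / logIter 2 k := by
    rw [le_div_iff₀ hL₂pos]; linarith
  have h5 : 0 ≤ 4 * Real.sqrt 3 * (logIter 3 k / (2 * logIter 2 k)) :=
    mul_nonneg (by positivity) hfrac
  have h6 : (4 * Real.sqrt 3 - ε) ≤
      4 * Real.sqrt 3 * (1 + logIter 3 k / (2 * logIter 2 k) + C / logIter 2 k) := by
    have : 4 * Real.sqrt 3 * (1 + logIter 3 k / (2 * logIter 2 k) + C / logIter 2 k) =
        4 * Real.sqrt 3 + 4 * Real.sqrt 3 * (logIter 3 k / (2 * logIter 2 k)) +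
          4 * Real.sqrt 3 * C / logIter 2 k := by ring
    rw [this]; linarith
  calc (4 * Real.sqrt 3 - ε) * s
      ≤ (4 * Real.sqrt 3 * (1 + logIter 3 k / (2 * logIter 2 k) + C / logIter 2 k)) * s :=
        mul_le_mul_of_nonneg_right h6 hs
    _ = 4 * (Real.sqrt 3 * s) * (1 + logIter 3 k / (2 * logIter 2 k) + C / logIter 2 k) := by
        ring

/-- **Robert–Stewart–Tenenbaum's remark, lower half: Conjecture A (1·6) ⟹ (1·4) with
`A₃ = 4√3 − ε`.** "We remark that it follows from Conjecture A that for each `ε > 0`, we can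
select `A₂ = 4√3 + ε` in (1·3) for large `k`, and `A₃ = 4√3 − ε` in (1·4)": assuming the named
conjecture `RSTConjectureALower` (taken as a hypothesis — it is open), for every `ε > 0` there are
infinitely many abc triples with `c > k · exp((4√3 − ε) √(log k / log₂ k))`, `k = rad(abc)`,
`log₂ = logIter 2`. [cite: RobertStewartTenenbaum2014, §1, Remark after Conjecture A] -/
theorem RSTConjectureALower.vanFrankenhuijsenForm (h : RSTConjectureALower) (ε : ℝ)
    (hε : 0 < ε) :
    {t : ℕ × ℕ × ℕ | IsABCTriple t.1 t.2.1 t.2.2 ∧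
      (rad t.1 t.2.1 t.2.2 : ℝ) *
          Real.exp ((4 * Real.sqrt 3 - ε) *
            Real.sqrt (Real.log (rad t.1 t.2.1 t.2.2 : ℕ) / logIter 2 (rad t.1 t.2.1 t.2.2 : ℕ))) <
        t.2.2}.Infinite := by
  obtain ⟨C₂, hC⟩ := h
  set B : ℝ := 4 * Real.sqrt 3 * |C₂| / ε
  refine infinite_lowerFamily_mono (G₁ := fun k : ℕ => (k : ℝ) * Real.exp (rstExponent C₂ k))
    (G₂ := fun k : ℕ => (k : ℝ) * Real.exp ((4 * Real.sqrt 3 - ε) *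
      Real.sqrt (Real.log k / logIter 2 k))) ⌈Real.exp (Real.exp B)⌉₊ ?_ hC
  intro k hk
  have hkB : Real.exp (Real.exp B) ≤ (k : ℝ) :=
    le_trans (Nat.le_ceil _) (by exact_mod_cast hk)
  exact mul_le_mul_of_nonneg_left
    (Real.exp_le_exp.mpr
      (rstExponent_ge hε (le_logIter_two_of_le hkB)))
    (Nat.cast_nonneg k)

/-- **Any lower bound of the form (1·4) with `A > 0` implies the Stewart–Tijdeman form.** If
infinitely many abc triples satisfy `c > k · exp(A √(log k / log₂ k))` with `A > 0`, then for
every `δ > 0` infinitely many satisfy `c > k · exp((4 − δ) √(log k) / log log k)`, i.e.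
`EpsilonCannotBeDropped` holds: for `log log k ≥ max(1, (4/A)²)` one has `log₂ k = log log k`
and `(4 − δ) √(log k) / log log k ≤ A √(log k / log log k)`. [folklore] -/
theorem epsilonCannotBeDropped_of_lowerForm {A : ℝ} (hA : 0 < A)
    (h : {t : ℕ × ℕ × ℕ | IsABCTriple t.1 t.2.1 t.2.2 ∧
      (rad t.1 t.2.1 t.2.2 : ℝ) *
          Real.exp (A *
            Real.sqrt (Real.log (rad t.1 t.2.1 t.2.2 : ℕ) / logIter 2 (rad t.1 t.2.1 t.2.2 : ℕ))) <
        t.2.2}.Infinite) :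
    EpsilonCannotBeDropped := by
  intro δ _hδ
  set B : ℝ := max 1 ((4 / A) ^ 2)
  refine infinite_lowerFamily_mono
    (G₁ := fun k : ℕ => (k : ℝ) * Real.exp (A * Real.sqrt (Real.log k / logIter 2 k)))
    (G₂ := fun k : ℕ => (k : ℝ) *
      Real.exp ((4 - δ) * Real.sqrt (Real.log k) / Real.log (Real.log k)))
    ⌈Real.exp (Real.exp B)⌉₊ ?_ h
  intro k hk
  have hkB : Real.exp (Real.exp B) ≤ (k : ℝ) :=
    le_trans (Nat.le_ceil _) (by exact_mod_cast hk)
  refine mul_le_mul_of_nonneg_left (Real.exp_le_exp.mpr ?_) (Nat.cast_nonneg k)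
  -- the exponent comparison `(4 - δ) √(log k) / log log k ≤ A √(log k / log₂ k)`
  have hkpos : 0 < (k : ℝ) := lt_of_lt_of_le (Real.exp_pos _) hkB
  have h1 : Real.exp B ≤ Real.log k := (Real.le_log_iff_exp_le hkpos).mpr hkB
  have hlogpos : 0 < Real.log (k : ℝ) := lt_of_lt_of_le (Real.exp_pos _) h1
  have hB1 : 1 ≤ B := le_max_left _ _
  have hBA : (4 / A) ^ 2 ≤ B := le_max_right _ _
  have hlog1 : 1 ≤ Real.log (k : ℝ) := le_trans (by linarith [Real.add_one_le_exp B]) h1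
  have h2 : B ≤ Real.log (Real.log k) := (Real.le_log_iff_exp_le hlogpos).mpr h1
  set u := Real.log (Real.log (k : ℝ))
  have hu1 : 1 ≤ u := le_trans hB1 h2
  have hupos : 0 < u := by linarith
  have hL₂ : logIter 2 (k : ℝ) = u := by
    rw [logIter_two, max_eq_right hlog1, max_eq_right hu1]
  rw [hL₂, Real.sqrt_div' _ hupos.le]
  set r := Real.sqrt (Real.log (k : ℝ))
  have hr0 : 0 ≤ r := Real.sqrt_nonneg _
  have hsu_pos : 0 < Real.sqrt u := Real.sqrt_pos.mpr hupos
  have hsu : 4 / A ≤ Real.sqrt u := by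
    have := Real.sqrt_le_sqrt (le_trans hBA h2)
    rwa [Real.sqrt_sq (div_nonneg (by norm_num) hA.le)] at this
  have h4 : 4 ≤ A * Real.sqrt u := by
    have := mul_le_mul_of_nonneg_left hsu hA.le
    rwa [mul_div_cancel₀ _ hA.ne'] at this
  have hsplit : (4 - δ) * r / u = ((4 - δ) / Real.sqrt u) * (r / Real.sqrt u) := by
    rw [div_mul_div_comm, Real.mul_self_sqrt hupos.le]
  rw [hsplit]
  refine mul_le_mul_of_nonneg_right ?_ (div_nonneg hr0 hsu_pos.le)
  rw [div_le_iff₀ hsu_pos]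
  linarith

/-- **Conjecture A's lower half lies beyond the Stewart–Tijdeman barrier**: `RSTConjectureALower`
implies `EpsilonCannotBeDropped` (the paper's remark with `ε = 1`, `A₃ = 4√3 − 1 > 0`, then
`epsilonCannotBeDropped_of_lowerForm`). In particular (1·6) is strictly stronger in shape than
every proved lower bound ((1·7) and its improvements), consistent with its status as an open
conjecture. [cite: RobertStewartTenenbaum2014, §1, Remark after Conjecture A] -/
theorem RSTConjectureALower.epsilonCannotBeDropped (h : RSTConjectureALower) :
    EpsilonCannotBeDropped := by
  have h3 : 1 ≤ Real.sqrt 3 := by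
    rw [← Real.sqrt_one]; exact Real.sqrt_le_sqrt (by norm_num)
  exact epsilonCannotBeDropped_of_lowerForm (A := 4 * Real.sqrt 3 - 1) (by linarith)
    (h.vanFrankenhuijsenForm 1 one_pos)


/-! ### Audit 2026-08-15 (barrier audit D-0021): the `blocks:` clause made formal

Two additions. (1) `EpsilonCannotBeDropped.not_subST_strengthening`: the named fact implies the
`blocks:` sentence of the catalogue entry verbatim — no strengthening of abc of the form
`c ≤ C · rad(abc) · F(rad(abc))` with `log F(N) ≤ κ √(log N) / log log N` for all large `N` and some
`κ < 4` holds for all abc triples (previously "the elementary consequence of the displayed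
inequality, not a printed statement"; the polylogarithmic case `F(N) = (log N)^A` is proved
unconditionally in the sibling file `EpsilonCannotBeDroppedPolylog.lean`). No `S`-unit theorem is
needed: triples of the infinite family with small radical have bounded `c` under the hypothesis to
be refuted, so they are finitely many (`finite_isABCTriple_le`). (2) `not_abc_uniform_constant`: abc
with one constant serving every `ε > 0` is false, by `ε → 0⁺` in `not_abc_epsilon_zero`
[cite: GranvilleTucker2002, p. 1227]. -/


/-- Growth of the Stewart–Tijdeman exponent: for `B ≥ 1` and `x ≥ exp(exp(16 B))` one has
`B ≤ √(log x) / log log x` (write `u = log log x ≥ 16B`; then `√(log x) = e^{u/2} ≥ u²/8 ≥ B u`).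
[folklore] -/
theorem le_sqrt_log_div_loglog {B x : ℝ} (hB : 1 ≤ B) (hx : Real.exp (Real.exp (16 * B)) ≤ x) :
    B ≤ Real.sqrt (Real.log x) / Real.log (Real.log x) := by
  have hxpos : 0 < x := lt_of_lt_of_le (Real.exp_pos _) hx
  have h1 : Real.exp (16 * B) ≤ Real.log x := (Real.le_log_iff_exp_le hxpos).mpr hx
  have hlogpos : 0 < Real.log x := lt_of_lt_of_le (Real.exp_pos _) h1
  set u := Real.log (Real.log x) with hu
  have hu16 : 16 * B ≤ u := (Real.le_log_iff_exp_le hlogpos).mpr h1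
  have hupos : 0 < u := by linarith
  have hlogx : Real.log x = Real.exp u := by rw [hu, Real.exp_log hlogpos]
  have hsqrt : Real.sqrt (Real.log x) = Real.exp (u / 2) := by
    rw [hlogx, Real.sqrt_eq_iff_mul_self_eq_of_pos (Real.exp_pos _), ← Real.exp_add]
    congr 1; ring
  rw [hsqrt, le_div_iff₀ hupos]
  have hq : 1 + u / 2 + (u / 2) ^ 2 / 2 ≤ Real.exp (u / 2) :=
    Real.quadratic_le_exp_of_nonneg (by linarith)
  nlinarith

/-- **The `blocks:` clause of `EpsilonCannotBeDropped`, formally.** Assume the Stewart–Tijdeman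
lower bound `EpsilonCannotBeDropped`. Then no strengthening of abc of the form
`c ≤ C · rad(abc) · F(rad(abc))` can hold for all abc triples as soon as
`log F(N) ≤ κ √(log N) / log log N` for all large `N` with some `κ < 4` (`F > 0` there).
(Take `δ = η = (4 − κ)/2`; a triple of the infinite family with `c` beyond the finitely many
exceptions has `rad ≥ K₀`, and then `e^{η √(log R)/log log R} < C` contradicts
`le_sqrt_log_div_loglog`.) [folklore] -/
theorem EpsilonCannotBeDropped.not_subST_strengthening (h : EpsilonCannotBeDropped) {κ : ℝ}
    (hκ : κ < 4) (C : ℝ) {F : ℕ → ℝ} (K : ℕ)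
    (hF : ∀ N : ℕ, K ≤ N → 0 < F N ∧
      Real.log (F N) ≤ κ * Real.sqrt (Real.log N) / Real.log (Real.log N)) :
    ¬ ∀ a b c : ℕ, IsABCTriple a b c → (c : ℝ) ≤ C * (rad a b c : ℝ) * F (rad a b c) := by
  intro hall
  set η : ℝ := (4 - κ) / 2 with hη
  have hη0 : 0 < η := by rw [hη]; linarith
  have hS := h η hη0
  -- thresholds
  set C₁ : ℝ := max C 1 with hC₁
  have hC₁1 : 1 ≤ C₁ := le_max_right _ _
  have hC₁0 : 0 < C₁ := by linarith
  have hCC₁ : C ≤ C₁ := le_max_left _ _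
  set B : ℝ := Real.log C₁ / η + 1 with hB
  have hB1 : 1 ≤ B := by
    have : 0 ≤ Real.log C₁ / η := div_nonneg (Real.log_nonneg hC₁1) hη0.le
    rw [hB]; linarith
  set K₀ : ℕ := max K ⌈Real.exp (Real.exp (16 * B))⌉₊ with hK₀
  -- remove the finitely many triples with small `c`
  set Mb : ℕ := ⌈∑ k ∈ Finset.range K₀, |C * (k : ℝ) * F k|⌉₊ with hMb
  obtain ⟨⟨a, b, c⟩, ⟨habc, hlt⟩, hnot⟩ := (hS.sdiff (finite_isABCTriple_le Mb)).nonempty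
  simp only [Set.mem_setOf_eq, not_and, not_le] at hnot habc hlt
  have hcMb : Mb < c := hnot habc
  have hle := hall a b c habc
  set R : ℕ := rad a b c with hR
  -- `R ≥ K₀`
  have hRK : K₀ ≤ R := by
    by_contra hlt'
    rw [not_le] at hlt'
    have h1 : C * (R : ℝ) * F R ≤ ∑ k ∈ Finset.range K₀, |C * (k : ℝ) * F k| :=
      le_trans (le_abs_self _)
        (Finset.single_le_sum (f := fun k : ℕ => |C * (k : ℝ) * F k|) (fun i _ => abs_nonneg _)
          (Finset.mem_range.mpr hlt'))
    have h2 : (∑ k ∈ Finset.range K₀, |C * (k : ℝ) * F k|) ≤ (Mb : ℝ) := Nat.le_ceil _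
    have h3 : ((Mb : ℕ) : ℝ) < ((c : ℕ) : ℝ) := by exact_mod_cast hcMb
    linarith
  have hRK' : K ≤ R := le_trans (le_max_left _ _) hRK
  have hRexp : Real.exp (Real.exp (16 * B)) ≤ (R : ℝ) :=
    le_trans (Nat.le_ceil _) (by exact_mod_cast le_trans (le_max_right _ _) hRK)
  obtain ⟨hFpos, hFlog⟩ := hF R hRK'
  have hRpos : (0 : ℝ) < R := lt_of_lt_of_le (Real.exp_pos _) hRexp
  obtain ⟨-, -, hsum, -⟩ := habc
  have hc0 : (0 : ℝ) < c := by exact_mod_cast (show 0 < c by omega)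
  set g : ℝ := Real.sqrt (Real.log R) / Real.log (Real.log R) with hg
  have hgB : B ≤ g := le_sqrt_log_div_loglog hB1 hRexp
  -- `F R ≤ exp (κ g)`
  have hFle : F R ≤ Real.exp (κ * g) := by
    calc F R = Real.exp (Real.log (F R)) := (Real.exp_log hFpos).symm
      _ ≤ Real.exp (κ * g) := Real.exp_le_exp.mpr (by rw [hg, ← mul_div_assoc]; exact hFlog)
  -- the family inequality: `R e^{κ g} e^{η g} < c`
  have hfam : (R : ℝ) * Real.exp (κ * g) * Real.exp (η * g) < c := by
    have : (4 - η) * Real.sqrt (Real.log R) / Real.log (Real.log R) = κ * g + η * g := by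
      rw [hg, hη]; ring
    calc (R : ℝ) * Real.exp (κ * g) * Real.exp (η * g)
        = (R : ℝ) * Real.exp ((4 - η) * Real.sqrt (Real.log R) / Real.log (Real.log R)) := by
          rw [this, Real.exp_add, mul_assoc]
      _ < c := hlt
  rcases le_or_gt C 0 with hC | hC
  · have : C * (R : ℝ) * F R ≤ 0 :=
      mul_nonpos_of_nonpos_of_nonneg (mul_nonpos_of_nonpos_of_nonneg hC hRpos.le) hFpos.le
    linarith
  · have hup : (c : ℝ) ≤ C₁ * ((R : ℝ) * Real.exp (κ * g)) :=
      calc (c : ℝ) ≤ C * (R : ℝ) * F R := hle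
        _ ≤ C₁ * (R : ℝ) * Real.exp (κ * g) := by gcongr
        _ = C₁ * ((R : ℝ) * Real.exp (κ * g)) := by ring
    have hpos : 0 < (R : ℝ) * Real.exp (κ * g) := mul_pos hRpos (Real.exp_pos _)
    have hexp : Real.exp (η * g) < C₁ := by
      by_contra hge
      rw [not_lt] at hge
      have := mul_le_mul_of_nonneg_left hge hpos.le
      linarith
    have hηg : η * g < Real.log C₁ := by
      rw [← Real.exp_lt_exp, Real.exp_log hC₁0]; exact hexp
    have hg' : g < Real.log C₁ / η := by
      rw [lt_div_iff₀ hη0]; linarith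
    have : g < B := by rw [hB]; linarith
    linarith

open Filter Topology in
/-- **No constant uniform in `ε`.** There is no single `C` with `c < C · rad(abc)^{1+ε}` for every
`ε > 0` and every abc triple: letting `ε → 0⁺` gives `c ≤ C · rad(abc)`, contradicting
`not_abc_epsilon_zero` (Granville–Tucker's example). [cite: GranvilleTucker2002, p. 1227] -/
theorem not_abc_uniform_constant :
    ¬ ∃ C : ℝ, ∀ ε : ℝ, 0 < ε →
      ∀ a b c : ℕ, IsABCTriple a b c → (c : ℝ) < C * ((rad a b c : ℕ) : ℝ) ^ (1 + ε) := by
  rintro ⟨C, hC⟩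
  refine not_abc_epsilon_zero ⟨C, fun a b c habc => ?_⟩
  have hR0 : ((rad a b c : ℕ) : ℝ) ≠ 0 := by
    have : 0 < rad a b c := by rw [rad_def]; exact Nat.radical_pos _
    exact_mod_cast this.ne'
  have ht : Tendsto (fun ε : ℝ => C * ((rad a b c : ℕ) : ℝ) ^ (1 + ε)) (𝓝[>] 0)
      (𝓝 (C * ((rad a b c : ℕ) : ℝ) ^ (1 + (0 : ℝ)))) := by
    apply Tendsto.const_mul
    have h1 : Tendsto (fun ε : ℝ => 1 + ε) (𝓝[>] (0 : ℝ)) (𝓝 (1 + 0)) :=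
      ((continuous_const_add (1 : ℝ)).tendsto 0).mono_left nhdsWithin_le_nhds
    exact (Real.continuousAt_const_rpow hR0).tendsto.comp h1
  rw [add_zero, Real.rpow_one] at ht
  refine ge_of_tendsto ht ?_
  filter_upwards [self_mem_nhdsWithin] with ε hε
  exact (hC ε hε a b c habc).le

/-! ### Discharge of `bright2024_lowerBound` (Bright 2024, Theorem 3.1) -/

/-- **Discharge of `bright2024_lowerBound`** (Bright 2024, Abstract and Theorem 3.1): there are
infinitely many abc triples with `c > rad(abc) · exp(6.563 · √(log c) / log log c)`. Obtained from
`Literature.NumberTheory.DiophantineGeometry.bright_infinite_abcTriples` (Rankin's bound on the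
kernel sublattice of the odd-prime lattice, Lemma 3.1, and the asymptotic optimisation of §3.1 with
the prime number theorem) at the Rankin parameter `x = 9/14` with `κ = 6.563`, the hypothesis
`6.563² e/32 < δ(9/14)` being the certified numerical inequality
`Literature.Analysis.SpecialFunctions.bright_rankin_constant_lt`.
[cite: Bright2024, Abstract and Theorem 3.1] -/
theorem bright2024_lowerBound_holds : bright2024_lowerBound :=
  Literature.NumberTheory.DiophantineGeometry.bright_infinite_abcTriples (x := 9 / 14)
    (κ := 6.563) (by norm_num) (by norm_num) (by norm_num)
    Literature.Analysis.SpecialFunctions.bright_rankin_constant_lt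

end Literature.Barriers.ABC

end
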